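import Mathlib.Analysis.Complex.CauchyIntegral
import Mathlib.Analysis.SpecialFunctions.ImproperIntegrals
import Mathlib.MeasureTheory.Measure.Lebesgue.Integral
import Mathlib.Analysis.Real.Pi.Bounds
import Literature.NumberTheory.LFunctions.ClassicalPsiErrorTerm
import Literature.NumberTheory.LFunctions.PerronTruncated
import HarnessLib

/-!
# Riesz means of a twisted von Mangoldt series: Perron, a shifted main term, and a contour shift

Topic `Literature/NumberTheory/LFunctions`. Everything in this file is PROVED.  It is the abstract
analytic engine of the twisted prime number theorem
`∑_{n ≤ x} Λ(n) χ(n) n^{-it} = δ_χ x^{1−it}/(1 − it) + O(ε x)` at a scale `X` with a zero-free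
rectangle of Vinogradov–Korobov width (`TwistedVonMangoldtSum.lean`; Lichtman 2020 Lemma 4.5,
Matomäki–Radziwiłł 2015 Lemma 2), in the Riesz-mean normalisation of Landau 1903 / Montgomery–Vaughan
§5.1 already used by the tree for the classical `ψ`-estimate (`ClassicalPsiErrorTerm.lean`):

* `TwistedRieszMean.integral_mainTerm_shifted` — the **main term with a shifted pole**: for `x ≥ 1`,
  `σ > 1` and `Re a = 1`,
  `(1/2π) ∫ x^{1+s} dt/((s − a) s (s + 1)) = x^{1+a}/(a(a+1)) − x/a + 1/(a+1)` (`s = σ + it`), from the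
  Mellin pair `𝟙_{(0,1]}(y)(y^{-a} − 1)/a ↔ 1/((s − a)s)` (`mellinInv_kernel_shifted_eq`) and the
  tree's `(1 − y)⁺ ↔ 1/(s(s+1))`, via `1/((s−a)s(s+1)) = (1/(a+1)) (1/((s−a)s) − 1/(s(s+1)))`;
* `TwistedRieszMean.norm_rieszMean_sub_le` — the **contour estimate**: for coefficients `|b(n)| ≤ Λ(n)`
  whose Dirichlet series is `δ/(s − a) + G(s)` on `σ > 1` (`|δ| ≤ 1`, `Re a = 1`), with `G`
  holomorphic and bounded by `B` on the closed rectangle `[σ₁, 2] × [−T, T]` (`1/2 ≤ σ₁ ≤ 1`, `T ≥ 1`):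
  for `x ≥ e²`,
  `‖∑_{n ≤ x} b(n)(x − n) − δ (x^{1+a}/(a(a+1)) − x/a + 1/(a+1))‖ ≤ x² ((2 log x + K₀)/T + 2 B x^{σ₁−1} + B/T²)`
  (Cauchy's theorem on the rectangle with the line `Re s = 1 + 1/log x`; the tails, the left side
  and the horizontal sides bounded as in Landau's method);
* `TwistedRieszMean.norm_sum_sub_le` — the **differencing step**: for `0 < x < y`,
  `‖∑_{n ≤ x} b(n) − δ x^a/a‖ ≤ (‖R(y) − δM(y)‖ + ‖R(x) − δM(x)‖)/(y − x) + (y − x)/2 + 1 + (ψ(y) − ψ(x))`,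
  where `R`, `M` are the Riesz mean and its main term and `ψ` is Chebyshev's function (the twisted
  coefficients being dominated by `Λ ≥ 0`).

## References

* H. L. Montgomery, R. C. Vaughan, *Multiplicative Number Theory I*, CUP 2007, §5.1 (5.19), §6.2
  (proof of Theorem 6.9). [MontgomeryVaughan2007]
* E. Landau, Math. Ann. 56 (1903), 645–670, §§5–8. [LandauMathAnn1903]
* K. Matomäki, M. Radziwiłł, *A note on the Liouville function in short intervals*,
  arXiv:1502.02374 (2015), Lemma 2; J. D. Lichtman, arXiv:2009.08969, Lemma 4.5 (the consumers).
  [Lichtman2020]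
-/

noncomputable section

open Complex Filter Set MeasureTheory Real intervalIntegral
open scoped Topology Interval ArithmeticFunction.vonMangoldt
open Literature.NumberTheory.LFunctions.ClassicalPsiData (kernel Phi norm_Phi_eq norm_kernel_le_inv_sq
  norm_kernel_le_four_div integrable_cpow_mul_LSeries_mul_kernel norm_add_add_add_sub_le)

namespace Literature.NumberTheory.LFunctions

namespace TwistedRieszMean

/-! ## The Mellin pair `𝟙_{(0,1]}(y) (y^{-a} − 1)/a ↔ 1/((s − a) s)` -/

/-- The Mellin transform of `f(y) = 𝟙_{(0,1]}(y)(y^{-a} − 1)/a` is `1/((s − a)s)` for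
`Re s > max(Re a, 0)`, `a ≠ 0` (`hasMellin_cpow_Ioc (−a)` minus `hasMellin_one_Ioc`, divided by
`a`: `(1/(s−a) − 1/s)/a = 1/((s−a)s)`). [folklore] -/
theorem hasMellin_shifted_indicator {a s : ℂ} (ha : a ≠ 0) (hs : 0 < s.re) (hsa : a.re < s.re) :
    HasMellin ((Ioc 0 1).indicator fun y : ℝ ↦ (((y : ℂ) ^ (-a) - 1) / a)) s
      (1 / ((s - a) * s)) := by
  have h1 := hasMellin_cpow_Ioc (-a) (s := s) (by simp; linarith)
  have h2 := hasMellin_one_Ioc hs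
  have h3 := hasMellin_sub h1.1 h2.1
  rw [h1.2, h2.2] at h3
  have h4 := hasMellin_const_smul h3.1 (a⁻¹ : ℂ)
  rw [h3.2] at h4
  have hs0 : s ≠ 0 := by rintro rfl; simp at hs
  have hsa0 : s - a ≠ 0 := by
    intro h; have := congrArg Complex.re h; simp at this; linarith
  have heq : (fun y : ℝ ↦ (a⁻¹ : ℂ) • ((Ioc 0 1).indicator (fun t : ℝ ↦ (t : ℂ) ^ (-a)) y -
      (Ioc 0 1).indicator (fun _ : ℝ ↦ (1 : ℂ)) y)) =
      (Ioc 0 1).indicator fun y : ℝ ↦ (((y : ℂ) ^ (-a) - 1) / a) := by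
    funext y
    by_cases hy : y ∈ Ioc (0 : ℝ) 1
    · simp only [Set.indicator_of_mem hy, smul_eq_mul]
      field_simp
    · simp [Set.indicator_of_notMem hy]
  rw [heq] at h4
  refine ⟨h4.1, ?_⟩
  rw [h4.2, smul_eq_mul, ← sub_eq_add_neg]
  field_simp
  ring

/-- Integrability of `t ↦ 1/((σ + it − a)(σ + it))` on `ℝ` for `σ > max(Re a, 0)`: by
`2|uv| ≥ …`, `1/(|s − a||s|) ≤ (1/|s − a|² + 1/|s|²)/2`, two translates of `1/(c² + t²)`. [folklore] -/
theorem integrable_kernel_shifted {a : ℂ} {σ : ℝ} (hσ : 0 < σ) (hsa : a.re < σ) :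
    Integrable fun t : ℝ ↦ 1 / (((σ : ℂ) + t * I - a) * ((σ : ℂ) + t * I)) := by
  have hne1 : ∀ t : ℝ, (σ : ℂ) + t * I - a ≠ 0 := fun t h ↦ by
    have := congrArg Complex.re h; simp at this; linarith
  have hne2 : ∀ t : ℝ, (σ : ℂ) + t * I ≠ 0 := fun t h ↦ by
    have := congrArg Complex.re h; simp at this; linarith
  have hc : Continuous fun t : ℝ ↦ 1 / (((σ : ℂ) + t * I - a) * ((σ : ℂ) + t * I)) :=
    Continuous.div continuous_const (by fun_prop) fun t ↦ mul_ne_zero (hne1 t) (hne2 t)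
  have hσa : 0 < σ - a.re := by linarith
  -- dominating function
  have hI1 : Integrable fun t : ℝ ↦ 1 / ((σ - a.re) ^ 2 + (t - a.im) ^ 2) :=
    (Literature.NumberTheory.LFunctions.integrable_inv_sq_add_sq hσa).comp_sub_right a.im
  have hI2 : Integrable fun t : ℝ ↦ 1 / (σ ^ 2 + t ^ 2) :=
    Literature.NumberTheory.LFunctions.integrable_inv_sq_add_sq hσ
  refine ((hI1.add hI2).div_const 2).mono' hc.aestronglyMeasurable (Eventually.of_forall fun t ↦ ?_)
  have hn1 : ‖(σ : ℂ) + t * I - a‖ ^ 2 = (σ - a.re) ^ 2 + (t - a.im) ^ 2 := by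
    rw [Complex.sq_norm, Complex.normSq_apply]; simp; ring
  have hn2 : ‖(σ : ℂ) + t * I‖ ^ 2 = σ ^ 2 + t ^ 2 := by
    rw [Complex.sq_norm, Complex.normSq_apply]; simp; ring
  set u : ℝ := ‖(σ : ℂ) + t * I - a‖ with hu
  set v : ℝ := ‖(σ : ℂ) + t * I‖ with hv
  have hu0 : 0 < u := norm_pos_iff.2 (hne1 t)
  have hv0 : 0 < v := norm_pos_iff.2 (hne2 t)
  rw [norm_div, norm_one, norm_mul, ← hu, ← hv, Pi.add_apply, ← hn1, ← hn2]
  rw [div_add_div _ _ (by positivity) (by positivity), div_div,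
    div_le_div_iff₀ (by positivity) (by positivity)]
  nlinarith [sq_nonneg (u - v), mul_pos hu0 hv0]

/-- **The shifted Perron kernel.** For `σ > max(Re a, 0)`, `a ≠ 0` and `y > 0`,
`(1/2πi) ∫_{(σ)} y^{−s} ds/((s − a)s) = 𝟙_{y ≤ 1} (y^{-a} − 1)/a` (Mellin inversion of
`hasMellin_shifted_indicator`). [folklore] -/
theorem mellinInv_kernel_shifted_eq {a : ℂ} {σ : ℝ} (ha : a ≠ 0) (hσ : 0 < σ) (hsa : a.re < σ)
    {y : ℝ} (hy : 0 < y) :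
    mellinInv σ (fun s ↦ 1 / ((s - a) * s)) y =
      if y ≤ 1 then ((y : ℂ) ^ (-a) - 1) / a else 0 := by
  set f : ℝ → ℂ := (Ioc 0 1).indicator fun y : ℝ ↦ (((y : ℂ) ^ (-a) - 1) / a) with hf
  have hmel : ∀ t : ℝ, mellin f (σ + t * I) = 1 / (((σ : ℂ) + t * I - a) * ((σ : ℂ) + t * I)) :=
    fun t ↦ (hasMellin_shifted_indicator (s := σ + t * I) ha (by simpa using hσ)
      (by simpa using hsa)).2
  have hconv : MellinConvergent f σ :=
    (hasMellin_shifted_indicator (s := σ) ha (by simpa using hσ) (by simpa using hsa)).1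
  have hvert : VerticalIntegrable (mellin f) σ := by
    unfold VerticalIntegrable
    exact (integrable_kernel_shifted hσ hsa).congr (Eventually.of_forall fun t ↦ (hmel t).symm)
  -- `f` agrees on `(0, ∞)` with the continuous function `g`
  set g : ℝ → ℂ := fun u ↦ if u ≤ 1 then ((u : ℂ) ^ (-a) - 1) / a else 0 with hg
  have hfeq : ∀ u : ℝ, 0 < u → f u = g u := by
    intro u hu
    by_cases hu1 : u ≤ 1
    · have hmem : u ∈ Ioc (0 : ℝ) 1 := ⟨hu, hu1⟩
      simp only [hf, hg, Set.indicator_of_mem hmem, if_pos hu1]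
    · have hmem : u ∉ Ioc (0 : ℝ) 1 := fun h ↦ hu1 h.2
      simp only [hf, hg, Set.indicator_of_notMem hmem, if_neg hu1]
  -- continuity of `g` at `y`
  have hcpow : ContinuousAt (fun u : ℝ ↦ ((u : ℂ) ^ (-a) - 1) / a) y := by
    have h1 : ContinuousAt (fun u : ℝ ↦ (u : ℂ) ^ (-a)) y :=
      continuousAt_ofReal_cpow_const y (-a) (Or.inr hy.ne')
    exact (h1.sub continuousAt_const).div_const _
  have hcontg : ContinuousAt g y := by
    rcases lt_trichotomy y 1 with hy1 | rfl | hy1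
    · have hev : g =ᶠ[𝓝 y] fun u ↦ ((u : ℂ) ^ (-a) - 1) / a := by
        filter_upwards [Iio_mem_nhds hy1] with u hu
        simp only [hg, if_pos (le_of_lt (mem_Iio.1 hu))]
      exact hcpow.congr hev.symm
    · -- at `y = 1` both branches tend to `0 = g 1`
      have hg1 : g 1 = 0 := by simp [hg]
      have hlim : Tendsto (fun u : ℝ ↦ ((u : ℂ) ^ (-a) - 1) / a) (𝓝 1) (𝓝 0) := by
        simpa using hcpow.tendsto
      rw [ContinuousAt, hg1]
      refine squeeze_zero_norm' (Eventually.of_forall fun u ↦ ?_)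
        (tendsto_zero_iff_norm_tendsto_zero.1 hlim)
      by_cases hu : u ≤ 1
      · simp only [hg, if_pos hu]; exact le_rfl
      · simp only [hg, if_neg hu, norm_zero]; exact norm_nonneg _
    · have hev : g =ᶠ[𝓝 y] fun _ ↦ (0 : ℂ) := by
        filter_upwards [Ioi_mem_nhds hy1] with u hu
        simp only [hg, if_neg (not_le.2 (mem_Ioi.1 hu))]
      exact continuousAt_const.congr hev.symm
  have hcont : ContinuousAt f y := by
    refine hcontg.congr ?_
    filter_upwards [Ioi_mem_nhds hy] with u hu using (hfeq u hu).symm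
  have hinv := mellinInv_mellin_eq σ f hy hconv hvert hcont
  change mellinInv σ (fun s ↦ 1 / ((s - a) * s)) y = g y
  rw [← hfeq y hy, ← hinv]
  unfold mellinInv
  congr 1
  refine integral_congr_ae (Eventually.of_forall fun t ↦ ?_)
  simp only [hmel t]

/-- The shifted kernel in the variable `x = 1/y`: for `σ > max(Re a, 0)`, `a ≠ 0` and `x ≥ 1`,
`(1/2π) ∫ x^{σ+it} dt/((σ + it − a)(σ + it)) = (x^a − 1)/a`. [folklore] -/
theorem integral_cpow_mul_kernel_shifted {a : ℂ} {σ : ℝ} (ha : a ≠ 0) (hσ : 0 < σ)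
    (hsa : a.re < σ) {x : ℝ} (hx : 1 ≤ x) :
    (1 / (2 * π) : ℂ) * ∫ t : ℝ, (x : ℂ) ^ ((σ : ℂ) + t * I) *
        (1 / (((σ : ℂ) + t * I - a) * ((σ : ℂ) + t * I))) = ((x : ℂ) ^ a - 1) / a := by
  have hx0 : 0 < x := by linarith
  have harg : (x : ℂ).arg ≠ π := by rw [arg_ofReal_of_nonneg hx0.le]; exact Real.pi_pos.ne
  have hK := mellinInv_kernel_shifted_eq ha hσ hsa (inv_pos.2 hx0)
  rw [if_pos (inv_le_one_of_one_le₀ hx)] at hK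
  have hxa : ((x⁻¹ : ℝ) : ℂ) ^ (-a) = (x : ℂ) ^ a := by
    rw [ofReal_inv, inv_cpow _ _ harg, cpow_neg, inv_inv]
  rw [hxa] at hK
  unfold mellinInv at hK
  rw [← hK, Complex.real_smul]
  push_cast
  congr 1
  refine integral_congr_ae (Eventually.of_forall fun t ↦ ?_)
  simp only [smul_eq_mul]
  congr 1
  rw [← ofReal_inv, show ((x⁻¹ : ℝ) : ℂ) = (x : ℂ)⁻¹ by push_cast; rfl, inv_cpow _ _ harg, cpow_neg,
    inv_inv]

/-- Integrability of `t ↦ x^{σ+it}/((σ + it − a)(σ + it))` (`σ > max(Re a, 0)`, `x > 0`). [folklore] -/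
theorem integrable_cpow_mul_kernel_shifted {a : ℂ} {σ : ℝ} (hσ : 0 < σ) (hsa : a.re < σ)
    {x : ℝ} (hx : 0 < x) :
    Integrable fun t : ℝ ↦ (x : ℂ) ^ ((σ : ℂ) + t * I) *
      (1 / (((σ : ℂ) + t * I - a) * ((σ : ℂ) + t * I))) := by
  have hx0 : (x : ℂ) ≠ 0 := ofReal_ne_zero.2 hx.ne'
  refine (integrable_kernel_shifted hσ hsa).bdd_mul (c := x ^ σ) ?_ (Eventually.of_forall fun t ↦ ?_)
  · refine Continuous.aestronglyMeasurable (continuous_iff_continuousAt.2 fun t ↦ ?_)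
    exact (continuousAt_const_cpow hx0).comp (f := fun t : ℝ ↦ ((σ : ℂ) + t * I)) (by fun_prop)
  · rw [norm_cpow_eq_rpow_re_of_pos hx]; simp

/-- **The main term with a shifted pole.** For `x ≥ 1`, `σ > 1` and `Re a = 1`,
`(1/2π) ∫_{−∞}^{∞} x^{1+s} dt/((s − a) s (s + 1)) = x^{1+a}/(a(a+1)) − x/a + 1/(a+1)`, `s = σ + it`:
the contribution of the polar part `δ/(s − a)` of a twisted Dirichlet series (`a = 1 − iτ`) to the
Riesz mean `∑_{n ≤ x} b(n)(x − n)`.  From `1/((s−a)s(s+1)) = (1/(a+1))(1/((s−a)s) − 1/(s(s+1)))` and the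
two kernel evaluations `integral_cpow_mul_kernel_shifted`, `RieszMean.integral_cpow_mul_kernel`; for
`a = 1` this is the tree's `RieszMean.integral_mainTerm` (`(x − 1)²/2`).
[cite: MontgomeryVaughan2007, §5.1 (5.19)] -/
theorem integral_mainTerm_shifted {a : ℂ} (ha : a.re = 1) {x : ℝ} (hx : 1 ≤ x) {σ : ℝ}
    (hσ : 1 < σ) :
    (1 / (2 * π) : ℂ) * ∫ t : ℝ, (x : ℂ) ^ (1 + ((σ : ℂ) + t * I)) * (1 / ((σ : ℂ) + t * I - a)) *
        (1 / (((σ : ℂ) + t * I) * ((σ : ℂ) + t * I + 1))) =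
      (x : ℂ) ^ (1 + a) / (a * (a + 1)) - x / a + 1 / (a + 1) := by
  have hx0' : 0 < x := by linarith
  have hx0 : (x : ℂ) ≠ 0 := ofReal_ne_zero.2 hx0'.ne'
  have hσ0 : 0 < σ := by linarith
  have hsa : a.re < σ := by rw [ha]; exact hσ
  have ha0 : a ≠ 0 := fun h ↦ by rw [h] at ha; simp at ha
  have ha1 : a + 1 ≠ 0 := fun h ↦ by
    have := congrArg Complex.re h; simp at this; linarith
  set A : ℝ → ℂ := fun t ↦ (x : ℂ) ^ ((σ : ℂ) + t * I) *
    (1 / (((σ : ℂ) + t * I - a) * ((σ : ℂ) + t * I))) with hA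
  set B : ℝ → ℂ := fun t ↦ (x : ℂ) ^ ((σ : ℂ) + t * I) *
    (1 / (((σ : ℂ) + t * I) * ((σ : ℂ) + t * I + 1))) with hB
  have hne : ∀ t : ℝ, ((σ : ℂ) + t * I - a) ≠ 0 ∧ ((σ : ℂ) + t * I) ≠ 0 ∧
      ((σ : ℂ) + t * I + 1) ≠ 0 := by
    intro t
    refine ⟨fun h ↦ ?_, fun h ↦ ?_, fun h ↦ ?_⟩ <;>
    · have := congrArg Complex.re h
      simp at this
      linarith
  have hpt : ∀ t : ℝ, (x : ℂ) ^ (1 + ((σ : ℂ) + t * I)) * (1 / ((σ : ℂ) + t * I - a)) *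
      (1 / (((σ : ℂ) + t * I) * ((σ : ℂ) + t * I + 1))) = ((x : ℂ) / (a + 1)) * (A t - B t) := by
    intro t
    obtain ⟨h1, h2, h3⟩ := hne t
    simp only [hA, hB]
    rw [cpow_add _ _ hx0, cpow_one]
    field_simp
    ring
  have hIA := integral_cpow_mul_kernel_shifted ha0 hσ0 hsa hx
  have hIB := RieszMean.integral_cpow_mul_kernel hσ0 hx0'
  have hintA := integrable_cpow_mul_kernel_shifted hσ0 hsa hx0'
  have hintB := RieszMean.integrable_cpow_mul_kernel hσ0 hx0'
  rw [integral_congr_ae (Eventually.of_forall hpt), MeasureTheory.integral_const_mul,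
    MeasureTheory.integral_sub hintA hintB]
  simp only [← hA, ← hB] at hIA hIB ⊢
  have hm : max (1 - x⁻¹) 0 = 1 - x⁻¹ := max_eq_left (by
    rw [sub_nonneg]; exact inv_le_one_of_one_le₀ hx)
  calc (1 / (2 * π) : ℂ) * ((x : ℂ) / (a + 1) * ((∫ t, A t) - ∫ t, B t))
      = (x : ℂ) / (a + 1) * ((1 / (2 * π) : ℂ) * (∫ t, A t) - (1 / (2 * π) : ℂ) * ∫ t, B t) := by
        ring
    _ = (x : ℂ) / (a + 1) * (((x : ℂ) ^ a - 1) / a - ((max (1 - x⁻¹) 0 : ℝ) : ℂ)) := by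
        rw [hIA, hIB]
    _ = (x : ℂ) ^ (1 + a) / (a * (a + 1)) - x / a + 1 / (a + 1) := by
        rw [hm, cpow_add _ _ hx0, cpow_one]
        push_cast
        field_simp
        ring

/-! ## The hypotheses of the contour estimate -/

/-- **Hypotheses of the twisted contour estimate** for coefficients `b`, a function `G`, constants
`δ, a ∈ ℂ` and a rectangle `[σ₁, 2] × [−T, T]` with bound `B`: `|b(n)| ≤ Λ(n)`; `|δ| ≤ 1`;
`Re a = 1`; `1/2 ≤ σ₁ ≤ 1 ≤ T`; `∑ b(n) n^{-s} = δ/(s − a) + G(s)` for `σ > 1`; `G` holomorphic on the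
closed rectangle and bounded by `B` there.  Model: `b(n) = Λ(n)χ(n)n^{-iτ}`, `a = 1 − iτ`,
`δ = 𝟙_{χ = χ₀}`, `G(s) = −L'/L(s + iτ, χ)` (resp. `−L₁'/L₁`), `σ₁ = 1 − (log X)^{-η}/2`.
[cite: MontgomeryVaughan2007, §6.2 (proof of Theorem 6.9)] -/
structure TwistData (b : ℕ → ℂ) (G : ℂ → ℂ) (δ a : ℂ) (σ₁ T B : ℝ) : Prop where
  /-- `|b(n)| ≤ Λ(n)`. -/
  norm_le : ∀ n, ‖b n‖ ≤ Λ n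
  /-- `|δ| ≤ 1`. -/
  norm_delta_le : ‖δ‖ ≤ 1
  /-- The pole sits on `Re s = 1`. -/
  a_re : a.re = 1
  /-- `1/2 ≤ σ₁`. -/
  half_le : 1 / 2 ≤ σ₁
  /-- `σ₁ ≤ 1`. -/
  le_one : σ₁ ≤ 1
  /-- `1 ≤ T`. -/
  one_le : 1 ≤ T
  /-- `0 ≤ B`. -/
  nonneg : 0 ≤ B
  /-- `∑ b(n) n^{-s} = δ/(s − a) + G(s)` for `σ > 1`. -/
  eq : ∀ s : ℂ, 1 < s.re → LSeries b s = δ / (s - a) + G s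
  /-- `G` is holomorphic on the closed rectangle `[σ₁, 2] × [−T, T]`. -/
  differentiableOn : DifferentiableOn ℂ G (Icc σ₁ 2 ×ℂ Icc (-T) T)
  /-- `|G| ≤ B` on the closed rectangle. -/
  bound : ∀ s ∈ Icc σ₁ 2 ×ℂ Icc (-T) T, ‖G s‖ ≤ B

/-- Coefficients dominated by `Λ` have absolutely convergent Dirichlet series on `σ > 1`. [folklore] -/
theorem LSeriesSummable_of_norm_le {b : ℕ → ℂ} (hb : ∀ n, ‖b n‖ ≤ Λ n) {s : ℂ} (hs : 1 < s.re) :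
    LSeriesSummable b s := by
  have h := (ArithmeticFunction.LSeriesSummable_vonMangoldt hs).norm
  refine Summable.of_norm_bounded h fun n ↦ ?_
  rcases eq_or_ne n 0 with rfl | hn
  · simp
  rw [LSeries.norm_term_eq, LSeries.norm_term_eq, if_neg hn, if_neg hn, Complex.norm_real,
    Real.norm_of_nonneg ArithmeticFunction.vonMangoldt_nonneg]
  exact div_le_div_of_nonneg_right (hb n) (by positivity)

/-- `∑ Λ(n) n^{-σ}`-domination: `‖∑ b(n) n^{-s}‖ ≤ ∑ Λ(n) n^{-σ} ≤ 1/(σ − 1) + K₀` for `1 < σ ≤ 2`,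
with the tree's absolute `K₀` (`exists_tsum_vonMangoldt_div_rpow_le`). [folklore] -/
theorem exists_norm_LSeries_le :
    ∃ K₀ : ℝ, 0 ≤ K₀ ∧ ∀ (b : ℕ → ℂ), (∀ n, ‖b n‖ ≤ Λ n) → ∀ s : ℂ, 1 < s.re → s.re ≤ 2 →
      ‖LSeries b s‖ ≤ 1 / (s.re - 1) + K₀ := by
  obtain ⟨K₀, hK₀, hK⟩ := exists_tsum_vonMangoldt_div_rpow_le
  refine ⟨K₀, hK₀, fun b hb s hs hs2 ↦ ?_⟩
  obtain ⟨hsum, hle⟩ := hK s.re hs hs2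
  have hterm : ∀ n, ‖LSeries.term b s n‖ ≤ Λ n / (n : ℝ) ^ s.re := by
    intro n
    rcases eq_or_ne n 0 with rfl | hn
    · simp
    rw [LSeries.norm_term_eq, if_neg hn]
    exact div_le_div_of_nonneg_right (hb n) (by positivity)
  have hs' : Summable fun n ↦ ‖LSeries.term b s n‖ :=
    Summable.of_nonneg_of_le (fun _ ↦ norm_nonneg _) hterm hsum
  calc ‖LSeries b s‖ ≤ ∑' n, ‖LSeries.term b s n‖ := norm_tsum_le_tsum_norm hs'
    _ ≤ ∑' n : ℕ, Λ n / (n : ℝ) ^ s.re := Summable.tsum_le_tsum hterm hs' hsum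
    _ ≤ 1 / (s.re - 1) + K₀ := hle

/-- The shifted main term of the Riesz mean, `M(x) = x^{1+a}/(a(a+1)) − x/a + 1/(a+1)`. [folklore] -/
def mainTerm (a : ℂ) (x : ℝ) : ℂ := (x : ℂ) ^ (1 + a) / (a * (a + 1)) - x / a + 1 / (a + 1)

/-- The complex Riesz mean `R(x) = ∑_{n ≤ x} b(n)(x − n)`. [cite: MontgomeryVaughan2007, §5.1 (5.19)] -/
def rieszMeanC (b : ℕ → ℂ) (x : ℝ) : ℂ := ∑ n ∈ Finset.Ioc 0 ⌊x⌋₊, b n * ((x : ℂ) - n)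

namespace TwistData

variable {b : ℕ → ℂ} {G : ℂ → ℂ} {δ a : ℂ} {σ₁ T B : ℝ}

/-- The polar coefficient is harmless: `‖δ/(s − a)‖ ≤ 1/(σ − 1)` for `σ > 1`. [folklore] -/
theorem norm_delta_div_le (h : TwistData b G δ a σ₁ T B) {s : ℂ} (hs : 1 < s.re) :
    ‖δ / (s - a)‖ ≤ 1 / (s.re - 1) := by
  have hre : (s - a).re = s.re - 1 := by simp [h.a_re]
  have hpos : 0 < s.re - 1 := by linarith
  have hn : s.re - 1 ≤ ‖s - a‖ := by rw [← hre]; exact Complex.re_le_norm _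
  rw [norm_div]
  calc ‖δ‖ / ‖s - a‖ ≤ 1 / ‖s - a‖ := div_le_div_of_nonneg_right h.norm_delta_le (norm_nonneg _)
    _ ≤ 1 / (s.re - 1) := one_div_le_one_div_of_le hpos hn

/-- On `σ > 1`, `G = L(b, ·) − δ/(· − a)` is bounded by `2/(σ − 1) + K₀` (`1 < σ ≤ 2`). [folklore] -/
theorem norm_G_le_of_one_lt (h : TwistData b G δ a σ₁ T B) {K₀ : ℝ}
    (hK : ∀ (b : ℕ → ℂ), (∀ n, ‖b n‖ ≤ Λ n) → ∀ s : ℂ, 1 < s.re → s.re ≤ 2 →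
      ‖LSeries b s‖ ≤ 1 / (s.re - 1) + K₀)
    {s : ℂ} (hs : 1 < s.re) (hs2 : s.re ≤ 2) : ‖G s‖ ≤ 2 / (s.re - 1) + K₀ := by
  have hG : G s = LSeries b s - δ / (s - a) := by rw [h.eq s hs]; ring
  rw [hG]
  calc ‖LSeries b s - δ / (s - a)‖ ≤ ‖LSeries b s‖ + ‖δ / (s - a)‖ := norm_sub_le _ _
    _ ≤ (1 / (s.re - 1) + K₀) + 1 / (s.re - 1) := add_le_add (hK b h.norm_le s hs hs2)
        (h.norm_delta_div_le hs)
    _ = 2 / (s.re - 1) + K₀ := by ring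

/-! ## Perron's formula minus the shifted main term -/

/-- `‖1/(s − a)‖ ≤ 1/(σ − 1)` for `σ > 1` (`Re a = 1`). [folklore] -/
theorem norm_one_div_sub_le (h : TwistData b G δ a σ₁ T B) {s : ℂ} (hs : 1 < s.re) :
    ‖1 / (s - a)‖ ≤ 1 / (s.re - 1) := by
  have hre : (s - a).re = s.re - 1 := by simp [h.a_re]
  have hpos : 0 < s.re - 1 := by linarith
  have hn : s.re - 1 ≤ ‖s - a‖ := by rw [← hre]; exact Complex.re_le_norm _
  rw [norm_div, norm_one]
  exact one_div_le_one_div_of_le hpos hn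

/-- Integrability on `Re s = σ > 1` of the polar piece `x^{1+s} (1/(s − a))/(s(s+1))`. [folklore] -/
theorem integrable_polar (h : TwistData b G δ a σ₁ T B) {x : ℝ} (hx : 0 < x) {σ : ℝ} (hσ : 1 < σ) :
    Integrable fun t : ℝ ↦ (x : ℂ) ^ (1 + (σ + t * I)) * (1 / (σ + t * I - a)) *
      (1 / ((σ + t * I) * (σ + t * I + 1))) := by
  have hx0 : (x : ℂ) ≠ 0 := ofReal_ne_zero.2 hx.ne'
  have hne : ∀ t : ℝ, (σ : ℂ) + t * I - a ≠ 0 := fun t h' ↦ by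
    have := congrArg Complex.re h'; simp [h.a_re] at this; linarith
  refine (Literature.NumberTheory.LFunctions.integrable_kernel (by linarith : 0 < σ)).bdd_mul
    (c := x ^ (1 + σ) * (1 / (σ - 1))) ?_ (Eventually.of_forall fun t ↦ ?_)
  · refine Continuous.aestronglyMeasurable (Continuous.mul ?_ ?_)
    · refine continuous_iff_continuousAt.2 fun t ↦ ?_
      exact (continuousAt_const_cpow hx0).comp (f := fun t : ℝ ↦ 1 + ((σ : ℂ) + t * I))
        (by fun_prop)
    · exact continuous_const.div (by fun_prop) hne
  · have h1σ : (1 + ((σ : ℂ) + t * I)).re = 1 + σ := by simp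
    have hd := h.norm_one_div_sub_le (s := σ + t * I) (by simp [hσ])
    simp only [add_re, ofReal_re, mul_re, I_re, mul_zero, ofReal_im, I_im, mul_one, sub_self,
      add_zero] at hd
    rw [norm_mul, norm_cpow_eq_rpow_re_of_pos hx, h1σ]
    exact mul_le_mul_of_nonneg_left hd (by positivity)

/-- Integrability on `Re s = σ > 1` of `Φ_x(s) = x^{1+s} G(s)/(s(s+1))` (difference of the Perron
integrand and the polar piece). [folklore] -/
theorem integrable_Phi (h : TwistData b G δ a σ₁ T B) {x : ℝ} (hx : 0 < x) {σ : ℝ} (hσ : 1 < σ) :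
    Integrable fun t : ℝ ↦ Phi G x (σ + t * I) := by
  have hs : LSeriesSummable b (σ : ℂ) := LSeriesSummable_of_norm_le h.norm_le (by simp [hσ])
  have hintP : Integrable fun t : ℝ ↦ (x : ℂ) ^ (1 + (σ + t * I)) * LSeries b (σ + t * I) *
      (1 / ((σ + t * I) * (σ + t * I + 1))) :=
    integrable_cpow_mul_LSeries_mul_kernel _ hx (by linarith) hs
  refine (hintP.sub ((h.integrable_polar hx hσ).const_mul δ)).congr
    (Eventually.of_forall fun t ↦ ?_)
  simp only [Phi, kernel, Pi.sub_apply]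
  rw [h.eq _ (by simp [hσ])]
  ring

/-- **Perron's formula for `R(x)` with the shifted main term removed**: for `x ≥ 1` and `σ > 1`,
`R(x) − δ M(x) = (1/2π) ∫ x^{1+s} G(s)/(s(s+1)) dt`, `s = σ + it`. [cite: MontgomeryVaughan2007, §5.1 (5.19)] -/
theorem rieszMean_sub_mainTerm_eq (h : TwistData b G δ a σ₁ T B) {x : ℝ} (hx : 1 ≤ x) {σ : ℝ}
    (hσ : 1 < σ) :
    rieszMeanC b x - δ * mainTerm a x = (1 / (2 * π) : ℂ) * ∫ t : ℝ, Phi G x (σ + t * I) := by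
  have hx0 : 0 < x := by linarith
  have hs : LSeriesSummable b (σ : ℂ) := LSeriesSummable_of_norm_le h.norm_le (by simp [hσ])
  have hP := RieszMean.sum_mul_sub_eq_integral_LSeries b hx0 (by linarith) hs
  have hM := integral_mainTerm_shifted h.a_re hx hσ
  have hintP : Integrable fun t : ℝ ↦ (x : ℂ) ^ (1 + (σ + t * I)) * LSeries b (σ + t * I) *
      (1 / ((σ + t * I) * (σ + t * I + 1))) :=
    integrable_cpow_mul_LSeries_mul_kernel _ hx0 (by linarith) hs
  have hintQ := (h.integrable_polar hx0 hσ).const_mul δ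
  rw [rieszMeanC, hP, mainTerm, ← hM]
  rw [show ∀ A B : ℂ, (1 / (2 * π) : ℂ) * A - δ * ((1 / (2 * π) : ℂ) * B) =
    (1 / (2 * π) : ℂ) * (A - δ * B) from fun A B ↦ by ring]
  congr 1
  rw [← MeasureTheory.integral_const_mul, ← MeasureTheory.integral_sub hintP hintQ]
  refine integral_congr_ae (Eventually.of_forall fun t ↦ ?_)
  simp only [Phi, kernel]
  rw [h.eq _ (by simp [hσ])]
  ring

/-! ## Moving the segment to `Re s = σ₁` -/

/-- `Φ_x` is holomorphic on the closed rectangle `[σ₁, σ₀] × [−T, T]` (`σ₀ ≤ 2`). [folklore] -/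
theorem differentiableOn_Phi (h : TwistData b G δ a σ₁ T B) {x : ℝ} (hx : 0 < x) {σ₀ : ℝ}
    (hσ₁₀ : σ₁ ≤ σ₀) (hσ₀ : σ₀ ≤ 2) :
    DifferentiableOn ℂ (Phi G x) (uIcc σ₁ σ₀ ×ℂ uIcc (-T) T) := by
  have hx0 : (x : ℂ) ≠ 0 := ofReal_ne_zero.2 hx.ne'
  have hT := h.one_le
  rw [uIcc_of_le hσ₁₀, uIcc_of_le (by linarith : -T ≤ T)]
  have hsub : Icc σ₁ σ₀ ×ℂ Icc (-T) T ⊆ Icc σ₁ 2 ×ℂ Icc (-T) T := by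
    intro s hs
    exact ⟨⟨hs.1.1, hs.1.2.trans hσ₀⟩, hs.2⟩
  intro s hs
  obtain ⟨⟨hre1, hre2⟩, him1, him2⟩ := hs
  have hsre : 0 < s.re := by linarith [h.half_le]
  have h1 : DifferentiableAt ℂ (fun s : ℂ ↦ (x : ℂ) ^ (1 + s)) s :=
    ((differentiableAt_id).const_add 1).const_cpow (Or.inl hx0)
  have hs0 : s ≠ 0 := fun h' ↦ by simp [h'] at hsre
  have hs1 : s + 1 ≠ 0 := fun h' ↦ by
    have := congrArg Complex.re h'; simp at this; linarith
  have h3 : DifferentiableAt ℂ kernel s := by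
    unfold kernel
    exact (differentiableAt_const _).div (differentiableAt_id.mul (differentiableAt_id.add_const 1))
      (mul_ne_zero hs0 hs1)
  have hmem : s ∈ Icc σ₁ σ₀ ×ℂ Icc (-T) T := ⟨⟨hre1, hre2⟩, him1, him2⟩
  have hG : DifferentiableWithinAt ℂ G (Icc σ₁ σ₀ ×ℂ Icc (-T) T) s :=
    (h.differentiableOn s (hsub hmem)).mono hsub
  unfold Phi
  exact (h1.differentiableWithinAt.mul hG).mul h3.differentiableWithinAt

/-- **Cauchy's theorem on the rectangle `[σ₁, σ₀] × [−T, T]`**: the line integral over `Re s = σ₀`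
equals the two tails, plus the left side, plus `i` times (bottom minus top). [cite: LandauMathAnn1903, §6] -/
theorem integral_line_eq (h : TwistData b G δ a σ₁ T B) {x : ℝ} (hx : 0 < x) {σ₀ : ℝ}
    (hσ₀ : 1 < σ₀) (hσ₀2 : σ₀ ≤ 2) :
    ∫ t : ℝ, Phi G x (σ₀ + t * I) =
      (∫ t in Iic (-T), Phi G x (σ₀ + t * I)) + (∫ t in Ioi T, Phi G x (σ₀ + t * I)) +
      (∫ t in (-T)..T, Phi G x (σ₁ + t * I)) +
      I * (∫ u in σ₁..σ₀, Phi G x (u + (-T) * I)) - I * (∫ u in σ₁..σ₀, Phi G x (u + T * I)) := by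
  have hint := h.integrable_Phi hx hσ₀
  have hσ₁₀ : σ₁ ≤ σ₀ := by linarith [h.le_one]
  have hsplit1 := integral_Iic_add_Ioi (b := -T) hint.integrableOn hint.integrableOn
  have hsplit2 := integral_interval_add_Ioi (a := -T) (b := T) hint.integrableOn hint.integrableOn
  have hdiff := h.differentiableOn_Phi hx hσ₁₀ hσ₀2
  have H := Complex.integral_boundary_rect_eq_zero_of_differentiableOn (Phi G x) ⟨σ₁, -T⟩ ⟨σ₀, T⟩
    hdiff
  dsimp only at H
  simp only [smul_eq_mul, ofReal_neg, neg_mul] at H ⊢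
  have key : (∫ y : ℝ in (-T)..T, Phi G x (σ₀ + y * I)) =
      (∫ y : ℝ in (-T)..T, Phi G x (σ₁ + y * I)) +
        I * (∫ u : ℝ in σ₁..σ₀, Phi G x (u + -(T * I))) -
        I * (∫ u : ℝ in σ₁..σ₀, Phi G x (u + T * I)) := by
    have hI : I * I = -1 := I_mul_I
    linear_combination (-I) * H +
      ((∫ y : ℝ in (-T)..T, Phi G x (σ₀ + y * I)) -
        (∫ y : ℝ in (-T)..T, Phi G x (σ₁ + y * I))) * hI
  rw [← hsplit1, ← hsplit2, key]
  ring

/-! ## Bounds for the five pieces -/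

/-- **Pointwise bound on the line `Re s = σ₀`, `1 < σ₀ ≤ 2`, for `t ≠ 0`**:
`‖Φ_x(σ₀ + it)‖ ≤ (2/(σ₀ − 1) + K₀) x^{1+σ₀} t^{−2}`. [folklore] -/
theorem norm_Phi_le_line (h : TwistData b G δ a σ₁ T B) {K₀ : ℝ}
    (hK : ∀ (b : ℕ → ℂ), (∀ n, ‖b n‖ ≤ Λ n) → ∀ s : ℂ, 1 < s.re → s.re ≤ 2 →
      ‖LSeries b s‖ ≤ 1 / (s.re - 1) + K₀)
    {x : ℝ} (hx : 0 < x) {σ₀ : ℝ} (hσ₀ : 1 < σ₀) (hσ₀2 : σ₀ ≤ 2) {t : ℝ} (ht : t ≠ 0) :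
    ‖Phi G x (σ₀ + t * I)‖ ≤ (2 / (σ₀ - 1) + K₀) * x ^ (1 + σ₀) * (t ^ 2)⁻¹ := by
  have hG := h.norm_G_le_of_one_lt hK (s := σ₀ + t * I) (by simp [hσ₀]) (by simp [hσ₀2])
  have hre : ((σ₀ : ℂ) + t * I).re = σ₀ := by simp
  have him : ((σ₀ : ℂ) + t * I).im = t := by simp
  rw [hre] at hG
  have hk : ‖kernel (σ₀ + t * I)‖ ≤ (t ^ 2)⁻¹ := by
    have := norm_kernel_le_inv_sq (s := σ₀ + t * I) (by rw [him]; exact ht)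
    rwa [him, one_div] at this
  rw [norm_Phi_eq G hx, hre]
  have hK0 : 0 ≤ 2 / (σ₀ - 1) + K₀ := le_trans (norm_nonneg _) hG
  calc x ^ (1 + σ₀) * ‖G (σ₀ + t * I)‖ * ‖kernel (σ₀ + t * I)‖
      ≤ x ^ (1 + σ₀) * (2 / (σ₀ - 1) + K₀) * (t ^ 2)⁻¹ := by gcongr
    _ = (2 / (σ₀ - 1) + K₀) * x ^ (1 + σ₀) * (t ^ 2)⁻¹ := by ring

/-- **The upper tail**: `‖∫_T^∞ Φ_x(σ₀ + it) dt‖ ≤ (2/(σ₀−1) + K₀) x^{1+σ₀}/T`. [cite: LandauMathAnn1903, §6] -/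
theorem norm_integral_Ioi_le (h : TwistData b G δ a σ₁ T B) {K₀ : ℝ}
    (hK : ∀ (b : ℕ → ℂ), (∀ n, ‖b n‖ ≤ Λ n) → ∀ s : ℂ, 1 < s.re → s.re ≤ 2 →
      ‖LSeries b s‖ ≤ 1 / (s.re - 1) + K₀)
    {x : ℝ} (hx : 0 < x) {σ₀ : ℝ} (hσ₀ : 1 < σ₀) (hσ₀2 : σ₀ ≤ 2) :
    ‖∫ t in Ioi T, Phi G x (σ₀ + t * I)‖ ≤ (2 / (σ₀ - 1) + K₀) * x ^ (1 + σ₀) / T := by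
  have hT0 : 0 < T := by linarith [h.one_le]
  set g : ℝ → ℝ := fun t ↦ (2 / (σ₀ - 1) + K₀) * x ^ (1 + σ₀) * t ^ (-(2 : ℝ)) with hg
  have hgi : IntegrableOn g (Ioi T) :=
    (integrableOn_Ioi_rpow_of_lt (by norm_num : (-(2 : ℝ)) < -1) hT0).const_mul _
  have hbound : ∀ᵐ t : ℝ ∂(volume.restrict (Ioi T)), ‖Phi G x (σ₀ + t * I)‖ ≤ g t := by
    refine (ae_restrict_iff' measurableSet_Ioi).2 (Eventually.of_forall fun t (ht : T < t) ↦ ?_)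
    have ht0 : 0 < t := hT0.trans ht
    have := h.norm_Phi_le_line hK hx hσ₀ hσ₀2 ht0.ne'
    show ‖Phi G x (σ₀ + t * I)‖ ≤ (2 / (σ₀ - 1) + K₀) * x ^ (1 + σ₀) * t ^ (-(2 : ℝ))
    rwa [Real.rpow_neg ht0.le, Real.rpow_two]
  refine (norm_integral_le_of_norm_le hgi hbound).trans (le_of_eq ?_)
  rw [hg, MeasureTheory.integral_const_mul, integral_Ioi_rpow_of_lt (by norm_num) hT0]
  have : (-(2 : ℝ)) + 1 = -1 := by norm_num
  rw [this, Real.rpow_neg_one]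
  field_simp

/-- **The lower tail** (reflect `t ↦ −t`). [cite: LandauMathAnn1903, §6] -/
theorem norm_integral_Iic_le (h : TwistData b G δ a σ₁ T B) {K₀ : ℝ}
    (hK : ∀ (b : ℕ → ℂ), (∀ n, ‖b n‖ ≤ Λ n) → ∀ s : ℂ, 1 < s.re → s.re ≤ 2 →
      ‖LSeries b s‖ ≤ 1 / (s.re - 1) + K₀)
    {x : ℝ} (hx : 0 < x) {σ₀ : ℝ} (hσ₀ : 1 < σ₀) (hσ₀2 : σ₀ ≤ 2) :
    ‖∫ t in Iic (-T), Phi G x (σ₀ + t * I)‖ ≤ (2 / (σ₀ - 1) + K₀) * x ^ (1 + σ₀) / T := by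
  have hT0 : 0 < T := by linarith [h.one_le]
  rw [← integral_comp_neg_Ioi]
  set g : ℝ → ℝ := fun t ↦ (2 / (σ₀ - 1) + K₀) * x ^ (1 + σ₀) * t ^ (-(2 : ℝ)) with hg
  have hgi : IntegrableOn g (Ioi T) :=
    (integrableOn_Ioi_rpow_of_lt (by norm_num : (-(2 : ℝ)) < -1) hT0).const_mul _
  have hbound : ∀ᵐ t : ℝ ∂(volume.restrict (Ioi T)),
      ‖Phi G x (σ₀ + ((-t : ℝ) : ℂ) * I)‖ ≤ g t := by
    refine (ae_restrict_iff' measurableSet_Ioi).2 (Eventually.of_forall fun t (ht : T < t) ↦ ?_)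
    have ht0 : 0 < t := hT0.trans ht
    have := h.norm_Phi_le_line hK hx hσ₀ hσ₀2 (neg_ne_zero.2 ht0.ne')
    show ‖Phi G x (σ₀ + ((-t : ℝ) : ℂ) * I)‖ ≤ (2 / (σ₀ - 1) + K₀) * x ^ (1 + σ₀) * t ^ (-(2 : ℝ))
    rwa [Real.rpow_neg ht0.le, Real.rpow_two, ← neg_sq t]
  refine (norm_integral_le_of_norm_le hgi hbound).trans (le_of_eq ?_)
  rw [hg, MeasureTheory.integral_const_mul, integral_Ioi_rpow_of_lt (by norm_num) hT0]
  have : (-(2 : ℝ)) + 1 = -1 := by norm_num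
  rw [this, Real.rpow_neg_one]
  field_simp

/-- **The horizontal sides**: `‖∫_{σ₁}^{σ₀} Φ_x(u ± iT) du‖ ≤ B x^{1+σ₀} (σ₀ − σ₁)/T²`.
[cite: LandauMathAnn1903, §6] -/
theorem norm_integral_horizontal_le (h : TwistData b G δ a σ₁ T B) {x : ℝ} (hx : 1 ≤ x)
    {σ₀ : ℝ} (hσ₁₀ : σ₁ ≤ σ₀) (hσ₀2 : σ₀ ≤ 2) {T' : ℝ} (hT' : |T'| = T) :
    ‖∫ u in σ₁..σ₀, Phi G x (u + T' * I)‖ ≤ B * x ^ (1 + σ₀) / T ^ 2 * (σ₀ - σ₁) := by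
  have hx0 : 0 < x := by linarith
  have hT0 : 0 < T := by linarith [h.one_le]
  have hT'0 : T' ≠ 0 := by rintro rfl; simp at hT'; linarith
  have hb : ∀ u ∈ Ι σ₁ σ₀, ‖Phi G x (u + T' * I)‖ ≤ B * x ^ (1 + σ₀) / T ^ 2 := by
    intro u hu
    rw [uIoc_of_le hσ₁₀] at hu
    have him : ((u : ℂ) + T' * I).im = T' := by simp
    have hre : ((u : ℂ) + T' * I).re = u := by simp
    have hmem : ((u : ℂ) + T' * I) ∈ Icc σ₁ 2 ×ℂ Icc (-T) T := by
      refine ⟨⟨by rw [hre]; exact hu.1.le, by rw [hre]; linarith [hu.2]⟩, ?_, ?_⟩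
      · rw [him]; linarith [abs_le.1 hT'.le]
      · rw [him]; linarith [abs_le.1 hT'.le]
    have hG : ‖G (u + T' * I)‖ ≤ B := h.bound _ hmem
    have hK : ‖kernel (u + T' * I)‖ ≤ 1 / T ^ 2 := by
      have := norm_kernel_le_inv_sq (s := u + T' * I) (by rw [him]; exact hT'0)
      rwa [him, ← sq_abs, hT'] at this
    have hxu : x ^ (1 + u) ≤ x ^ (1 + σ₀) :=
      Real.rpow_le_rpow_of_exponent_le hx (by linarith [hu.2])
    rw [norm_Phi_eq G hx0, hre]
    have hB := h.nonneg
    calc x ^ (1 + u) * ‖G (u + T' * I)‖ * ‖kernel (u + T' * I)‖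
        ≤ x ^ (1 + σ₀) * B * (1 / T ^ 2) := by gcongr
      _ = B * x ^ (1 + σ₀) / T ^ 2 := by ring
  have := intervalIntegral.norm_integral_le_of_norm_le_const hb
  rwa [abs_of_nonneg (sub_nonneg.2 hσ₁₀)] at this

/-- **The left side** `Re s = σ₁`: `‖∫_{−T}^{T} Φ_x(σ₁ + it) dt‖ ≤ 4π B x^{1+σ₁}`
(`‖1/(s(s+1))‖ ≤ 4/(1 + t²)` for `σ₁ ≥ 1/2`, `∫ dt/(1 + t²) = π`). [cite: LandauMathAnn1903, §6] -/
theorem norm_integral_left_le (h : TwistData b G δ a σ₁ T B) {x : ℝ} (hx : 1 ≤ x) :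
    ‖∫ t in (-T)..T, Phi G x (σ₁ + t * I)‖ ≤ 4 * π * B * x ^ (1 + σ₁) := by
  have hx0 : 0 < x := by linarith
  have hB := h.nonneg
  have hT0 : 0 < T := by linarith [h.one_le]
  set M : ℝ := 4 * B * x ^ (1 + σ₁) with hM
  have hM0 : 0 ≤ M := by positivity
  set g : ℝ → ℝ := fun t ↦ M * (1 + t ^ 2)⁻¹ with hg
  have hgi : Integrable g := integrable_inv_one_add_sq.const_mul M
  have hb : ∀ᵐ t : ℝ, t ∈ Ioc (-T) T → ‖Phi G x (σ₁ + t * I)‖ ≤ g t := by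
    refine Eventually.of_forall fun t ht ↦ ?_
    have him : ((σ₁ : ℂ) + t * I).im = t := by simp
    have hre : ((σ₁ : ℂ) + t * I).re = σ₁ := by simp
    have hmem : ((σ₁ : ℂ) + t * I) ∈ Icc σ₁ 2 ×ℂ Icc (-T) T := by
      refine ⟨⟨by rw [hre], by rw [hre]; linarith [h.le_one]⟩, ?_, ?_⟩
      · rw [him]; exact ht.1.le
      · rw [him]; exact ht.2
    have hG : ‖G (σ₁ + t * I)‖ ≤ B := h.bound _ hmem
    have hK := norm_kernel_le_four_div h.half_le t
    rw [norm_Phi_eq G hx0, hre, hg]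
    calc x ^ (1 + σ₁) * ‖G (σ₁ + t * I)‖ * ‖kernel (σ₁ + t * I)‖
        ≤ x ^ (1 + σ₁) * B * (4 * (1 + t ^ 2)⁻¹) := by gcongr
      _ = M * (1 + t ^ 2)⁻¹ := by rw [hM]; ring
  have h1 := intervalIntegral.norm_integral_le_of_norm_le (by linarith : -T ≤ T) hb
    (hgi.intervalIntegrable)
  refine h1.trans ?_
  rw [intervalIntegral.integral_of_le (by linarith : -T ≤ T)]
  calc ∫ t in Ioc (-T) T, g t ≤ ∫ t, g t :=
        setIntegral_le_integral hgi (Eventually.of_forall fun t ↦ by simp only [hg]; positivity)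
    _ = M * π := by rw [hg, MeasureTheory.integral_const_mul, integral_univ_inv_one_add_sq]
    _ = 4 * π * B * x ^ (1 + σ₁) := by rw [hM]; ring

/-! ## The estimate for the Riesz mean -/

/-- **The contour estimate for the twisted Riesz mean**: under `TwistData b G δ a σ₁ T B`, for
`x ≥ e²` (so that `σ₀ = 1 + 1/log x ≤ 3/2` and `x^{σ₀} = e·x`),
`‖R(x) − δ M(x)‖ ≤ x² ((2 log x + K₀)/T + 2 B x^{σ₁ − 1} + 2 B/T²)`
with the absolute `K₀` of `exists_norm_LSeries_le`.  (Landau's method: Perron for the Riesz mean,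
the polar part evaluated exactly, Cauchy on `[σ₁, σ₀] × [−T, T]`, and the bounds for the tails
`|t| ≥ T` on `Re s = σ₀`, the left side and the horizontal sides.)
[cite: MontgomeryVaughan2007, Theorem 6.9 (proof)] [cite: LandauMathAnn1903, §§6–7] -/
theorem norm_rieszMean_sub_le (h : TwistData b G δ a σ₁ T B) {K₀ : ℝ} (hK₀ : 0 ≤ K₀)
    (hK : ∀ (b : ℕ → ℂ), (∀ n, ‖b n‖ ≤ Λ n) → ∀ s : ℂ, 1 < s.re → s.re ≤ 2 →
      ‖LSeries b s‖ ≤ 1 / (s.re - 1) + K₀)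
    {x : ℝ} (hx : Real.exp 2 ≤ x) :
    ‖rieszMeanC b x - δ * mainTerm a x‖ ≤
      x ^ 2 * ((2 * Real.log x + K₀) / T + 2 * B * x ^ (σ₁ - 1) + 2 * B / T ^ 2) := by
  have hx1 : 1 ≤ x := le_trans (by have := Real.add_one_le_exp (2 : ℝ); linarith) hx
  have hx0 : 0 < x := by linarith
  have hlog : 2 ≤ Real.log x := by
    rw [Real.le_log_iff_exp_le hx0]; exact hx
  have hlog0 : 0 < Real.log x := by linarith
  set σ₀ : ℝ := 1 + 1 / Real.log x with hσ₀def
  have hσ₀ : 1 < σ₀ := by rw [hσ₀def]; have := one_div_pos.2 hlog0; linarith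
  have hσ₀2 : σ₀ ≤ 3 / 2 := by
    rw [hσ₀def]
    have : 1 / Real.log x ≤ 1 / 2 := one_div_le_one_div_of_le (by norm_num) hlog
    linarith
  have hσ₀2' : σ₀ ≤ 2 := by linarith
  have hσ₁₀ : σ₁ ≤ σ₀ := by linarith [h.le_one]
  have hT := h.one_le
  have hT0 : 0 < T := by linarith
  have hB := h.nonneg
  -- `x^{1+σ₀} = e x²`
  have hxinv : x ^ (1 / Real.log x) = Real.exp 1 := by
    rw [Real.rpow_def_of_pos hx0, show Real.log x * (1 / Real.log x) = 1 by field_simp]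
  have hxσ₀ : x ^ (1 + σ₀) = Real.exp 1 * x ^ 2 := by
    rw [hσ₀def, show 1 + (1 + 1 / Real.log x) = 2 + 1 / Real.log x by ring,
      Real.rpow_add hx0, Real.rpow_two, hxinv, mul_comm]
  have hxσ₁ : x ^ (1 + σ₁) = x ^ 2 * x ^ (σ₁ - 1) := by
    rw [← Real.rpow_two, ← Real.rpow_add hx0]; congr 1; ring
  -- `2/(σ₀ - 1) + K₀ = 2 log x + K₀`
  have hK1 : 2 / (σ₀ - 1) + K₀ = 2 * Real.log x + K₀ := by
    rw [hσ₀def]; field_simp; ring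
  -- the decomposition
  rw [h.rieszMean_sub_mainTerm_eq hx1 hσ₀, h.integral_line_eq hx0 hσ₀ hσ₀2']
  have h1 := h.norm_integral_Iic_le hK hx0 hσ₀ hσ₀2'
  have h2 := h.norm_integral_Ioi_le hK hx0 hσ₀ hσ₀2'
  have h3 := h.norm_integral_left_le hx1
  have h4 := h.norm_integral_horizontal_le hx1 hσ₁₀ hσ₀2' (T' := -T) (by rw [abs_neg, abs_of_pos hT0])
  have h5 := h.norm_integral_horizontal_le hx1 hσ₁₀ hσ₀2' (T' := T) (abs_of_pos hT0)
  rw [hK1, hxσ₀] at h1 h2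
  rw [hxσ₀] at h4 h5
  rw [hxσ₁] at h3
  simp only [ofReal_neg] at h4
  have hπ : ‖(1 / (2 * π) : ℂ)‖ = 1 / (2 * π) := by
    rw [show (1 / (2 * π) : ℂ) = ((1 / (2 * π) : ℝ) : ℂ) by push_cast; ring]
    rw [Complex.norm_real, Real.norm_of_nonneg (by positivity)]
  rw [norm_mul, hπ]
  have hI : ‖I‖ = 1 := Complex.norm_I
  -- sum of the five pieces
  have hsum := norm_add_add_add_sub_le (∫ t in Iic (-T), Phi G x (σ₀ + t * I))
    (∫ t in Ioi T, Phi G x (σ₀ + t * I)) (∫ t in (-T)..T, Phi G x (σ₁ + t * I))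
    (I * ∫ u in σ₁..σ₀, Phi G x (u + (-T) * I)) (I * ∫ u in σ₁..σ₀, Phi G x (u + T * I))
  rw [norm_mul, norm_mul, hI, one_mul, one_mul] at hsum
  have hw : σ₀ - σ₁ ≤ 1 := by linarith [h.half_le]
  have hA0 : 0 ≤ 2 * Real.log x + K₀ := by positivity
  have he1 : Real.exp 1 ≤ 3 := by have := Real.exp_one_lt_d9; linarith
  have hπ3 : 3 < π := Real.pi_gt_three
  have hx2 : 0 < x ^ 2 := by positivity
  have hxσ : 0 < x ^ (σ₁ - 1) := Real.rpow_pos_of_pos hx0 _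
  -- piece bounds in final currency
  have e1 : (2 * Real.log x + K₀) * (Real.exp 1 * x ^ 2) / T ≤
      3 * (x ^ 2 * ((2 * Real.log x + K₀) / T)) := by
    rw [show 3 * (x ^ 2 * ((2 * Real.log x + K₀) / T)) =
      (2 * Real.log x + K₀) * (3 * x ^ 2) / T by ring]
    gcongr
  have e3 : 4 * π * B * (x ^ 2 * x ^ (σ₁ - 1)) = (2 * π) * (x ^ 2 * (2 * B * x ^ (σ₁ - 1))) := by
    ring
  have e4 : B * (Real.exp 1 * x ^ 2) / T ^ 2 * (σ₀ - σ₁) ≤ 3 * (x ^ 2 * (B / T ^ 2)) := by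
    calc B * (Real.exp 1 * x ^ 2) / T ^ 2 * (σ₀ - σ₁) ≤ B * (Real.exp 1 * x ^ 2) / T ^ 2 * 1 := by
          gcongr
      _ ≤ B * (3 * x ^ 2) / T ^ 2 * 1 := by gcongr
      _ = 3 * (x ^ 2 * (B / T ^ 2)) := by ring
  calc 1 / (2 * π) * ‖(∫ t in Iic (-T), Phi G x (σ₀ + t * I)) + (∫ t in Ioi T, Phi G x (σ₀ + t * I)) +
        (∫ t in (-T)..T, Phi G x (σ₁ + t * I)) + I * (∫ u in σ₁..σ₀, Phi G x (u + (-T) * I)) -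
        I * (∫ u in σ₁..σ₀, Phi G x (u + T * I))‖
      ≤ 1 / (2 * π) * (3 * (x ^ 2 * ((2 * Real.log x + K₀) / T)) +
          3 * (x ^ 2 * ((2 * Real.log x + K₀) / T)) +
          (2 * π) * (x ^ 2 * (2 * B * x ^ (σ₁ - 1))) +
          3 * (x ^ 2 * (B / T ^ 2)) + 3 * (x ^ 2 * (B / T ^ 2))) := by
        refine mul_le_mul_of_nonneg_left (hsum.trans ?_) (by positivity)
        rw [← e3]
        linarith
    _ = (3 / π) * (x ^ 2 * ((2 * Real.log x + K₀) / T)) + x ^ 2 * (2 * B * x ^ (σ₁ - 1)) +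
          (3 / π) * (x ^ 2 * (B / T ^ 2)) := by
        field_simp
        ring
    _ ≤ 1 * (x ^ 2 * ((2 * Real.log x + K₀) / T)) + x ^ 2 * (2 * B * x ^ (σ₁ - 1)) +
          2 * (x ^ 2 * (B / T ^ 2)) := by
        have hq : 3 / π ≤ 1 := by rw [div_le_one Real.pi_pos]; exact hπ3.le
        have hq2 : 3 / π ≤ 2 := by linarith
        gcongr
    _ = x ^ 2 * ((2 * Real.log x + K₀) / T + 2 * B * x ^ (σ₁ - 1) + 2 * B / T ^ 2) := by ring

end TwistData

/-! ## From the Riesz mean to the summatory function -/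

/-- `R(y) − R(x) = (y − x) U(x) + ∑_{⌊x⌋ < n ≤ ⌊y⌋} b(n)(y − n)` for `0 ≤ x ≤ y`, where
`U(x) = ∑_{n ≤ x} b(n)`. [cite: LandauMathAnn1903, §8] -/
theorem rieszMeanC_sub_eq (b : ℕ → ℂ) {x y : ℝ} (hxy : x ≤ y) :
    rieszMeanC b y - rieszMeanC b x =
      (((y - x : ℝ)) : ℂ) * ∑ n ∈ Finset.Ioc 0 ⌊x⌋₊, b n +
        ∑ n ∈ Finset.Ioc ⌊x⌋₊ ⌊y⌋₊, b n * ((y : ℂ) - n) := by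
  have hfl : ⌊x⌋₊ ≤ ⌊y⌋₊ := Nat.floor_mono hxy
  unfold rieszMeanC
  rw [← Finset.Ioc_union_Ioc_eq_Ioc (Nat.zero_le _) hfl,
    Finset.sum_union (Finset.Ioc_disjoint_Ioc_of_le le_rfl), Finset.mul_sum, add_sub_right_comm,
    ← Finset.sum_sub_distrib]
  congr 1
  refine Finset.sum_congr rfl fun n _ ↦ ?_
  push_cast
  ring

/-- The boundary sum is dominated by `ψ(y) − ψ(x)`: `‖∑_{⌊x⌋ < n ≤ ⌊y⌋} b(n)(y − n)‖ ≤ (y − x)(ψ(y) − ψ(x))`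
for `x ≤ y` (`|b| ≤ Λ`, `0 ≤ y − n ≤ y − x` on the range). [folklore] -/
theorem norm_boundary_sum_le {b : ℕ → ℂ} (hb : ∀ n, ‖b n‖ ≤ Λ n) {x y : ℝ} (hxy : x ≤ y) :
    ‖∑ n ∈ Finset.Ioc ⌊x⌋₊ ⌊y⌋₊, b n * ((y : ℂ) - n)‖ ≤
      (y - x) * (Chebyshev.psi y - Chebyshev.psi x) := by
  have hfl : ⌊x⌋₊ ≤ ⌊y⌋₊ := Nat.floor_mono hxy
  have hψ : Chebyshev.psi y - Chebyshev.psi x = ∑ n ∈ Finset.Ioc ⌊x⌋₊ ⌊y⌋₊, Λ n := by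
    unfold Chebyshev.psi
    rw [← Finset.Ioc_union_Ioc_eq_Ioc (Nat.zero_le _) hfl,
      Finset.sum_union (Finset.Ioc_disjoint_Ioc_of_le le_rfl)]
    ring
  rw [hψ, Finset.mul_sum]
  refine (norm_sum_le _ _).trans (Finset.sum_le_sum fun n hn ↦ ?_)
  rw [Finset.mem_Ioc] at hn
  have hΛ : 0 ≤ Λ n := ArithmeticFunction.vonMangoldt_nonneg
  have hn1 : x < n := by
    have := Nat.lt_of_floor_lt hn.1
    exact_mod_cast this
  have hn2 : (n : ℝ) ≤ y := by
    rcases lt_or_ge y 0 with hy | hy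
    · exfalso
      have : ⌊y⌋₊ = 0 := Nat.floor_eq_zero.2 (by linarith)
      omega
    · exact (Nat.cast_le.2 hn.2).trans (Nat.floor_le hy)
  have hyn : ‖(y : ℂ) - n‖ = y - n := by
    rw [show (y : ℂ) - n = ((y - n : ℝ) : ℂ) by push_cast; ring, Complex.norm_real,
      Real.norm_of_nonneg (by linarith)]
  rw [norm_mul, hyn]
  calc ‖b n‖ * (y - n) ≤ Λ n * (y - x) := mul_le_mul (hb n) (by linarith) (by linarith) hΛ
    _ = (y - x) * Λ n := mul_comm _ _

/-- `‖t^a − x^a‖ ≤ ‖a‖ (t − x)` for `0 < x ≤ t` and `Re a = 1` (`t^a − x^a = a∫ₓᵗ u^{a−1} du`,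
`|u^{a−1}| = 1`). [folklore] -/
theorem norm_cpow_sub_cpow_le {a : ℂ} (ha : a.re = 1) {x t : ℝ} (hx : 0 < x) (hxt : x ≤ t) :
    ‖(t : ℂ) ^ a - (x : ℂ) ^ a‖ ≤ ‖a‖ * (t - x) := by
  have ha0 : a ≠ 0 := fun h ↦ by rw [h] at ha; simp at ha
  have hint := integral_cpow (a := x) (b := t) (r := a - 1) (Or.inl (by simp [ha]))
  rw [sub_add_cancel] at hint
  have heq : (t : ℂ) ^ a - (x : ℂ) ^ a = a * ∫ u in x..t, (u : ℂ) ^ (a - 1) := by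
    rw [hint]; field_simp
  have hb : ∀ u ∈ Ι x t, ‖(u : ℂ) ^ (a - 1)‖ ≤ 1 := by
    intro u hu
    rw [uIoc_of_le hxt] at hu
    have hu0 : 0 < u := hx.trans hu.1
    rw [Complex.norm_cpow_eq_rpow_re_of_pos hu0]
    simp [ha]
  have h1 := intervalIntegral.norm_integral_le_of_norm_le_const hb
  rw [abs_of_nonneg (sub_nonneg.2 hxt), one_mul] at h1
  rw [heq, norm_mul]
  exact mul_le_mul_of_nonneg_left h1 (norm_nonneg _)

/-- **Differencing the main term**: for `0 < x < y` and `Re a = 1`,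
`‖(M(y) − M(x))/(y − x) − (x^a − 1)/a‖ ≤ (y − x)/2`, because
`(y^{1+a} − x^{1+a})/(1 + a) = ∫ₓʸ t^a dt = (y − x)x^a + ∫ₓʸ (t^a − x^a) dt` and
`|t^a − x^a| ≤ |a|(t − x)`. [folklore] -/
theorem norm_mainTerm_div_sub_le {a : ℂ} (ha : a.re = 1) {x y : ℝ} (hx : 0 < x) (hxy : x < y) :
    ‖(mainTerm a y - mainTerm a x) / (((y - x : ℝ)) : ℂ) - ((x : ℂ) ^ a - 1) / a‖ ≤ (y - x) / 2 := by
  have ha0 : a ≠ 0 := fun h ↦ by rw [h] at ha; simp at ha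
  have ha1 : a + 1 ≠ 0 := fun h ↦ by
    have := congrArg Complex.re h; norm_num [ha] at this
  have hyx : 0 < y - x := by linarith
  have hyx0 : (((y - x : ℝ)) : ℂ) ≠ 0 := ofReal_ne_zero.2 hyx.ne'
  -- `∫ₓʸ t^a dt = (y^{1+a} − x^{1+a})/(a+1)`
  have hint := integral_cpow (a := x) (b := y) (r := a) (Or.inl (by simp [ha]))
  have hii : IntervalIntegrable (fun t : ℝ ↦ (t : ℂ) ^ a) volume x y :=
    intervalIntegral.intervalIntegrable_cpow' (by simp [ha])
  -- the remainder integral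
  set Rm : ℂ := ∫ t in x..y, ((t : ℂ) ^ a - (x : ℂ) ^ a) with hRm
  have hRm_eq : Rm = ((y : ℂ) ^ (a + 1) - (x : ℂ) ^ (a + 1)) / (a + 1) -
      (((y - x : ℝ)) : ℂ) * (x : ℂ) ^ a := by
    rw [hRm, intervalIntegral.integral_sub hii intervalIntegrable_const, hint,
      intervalIntegral.integral_const, Complex.real_smul]
  have hRm_le : ‖Rm‖ ≤ ‖a‖ * (y - x) ^ 2 / 2 := by
    have hb : ∀ᵐ t : ℝ, t ∈ Ioc x y → ‖(t : ℂ) ^ a - (x : ℂ) ^ a‖ ≤ ‖a‖ * (t - x) :=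
      Eventually.of_forall fun t ht ↦ norm_cpow_sub_cpow_le ha hx ht.1.le
    have hgi : IntervalIntegrable (fun t : ℝ ↦ ‖a‖ * (t - x)) volume x y :=
      (continuous_const.mul (continuous_id.sub continuous_const)).intervalIntegrable _ _
    have h1 := intervalIntegral.norm_integral_le_of_norm_le hxy.le hb hgi
    refine h1.trans (le_of_eq ?_)
    rw [intervalIntegral.integral_const_mul, intervalIntegral.integral_sub intervalIntegrable_id
      intervalIntegrable_const, integral_id, intervalIntegral.integral_const, smul_eq_mul]
    ring
  -- the identity
  have hid : (mainTerm a y - mainTerm a x) / (((y - x : ℝ)) : ℂ) - ((x : ℂ) ^ a - 1) / a =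
      Rm / (a * (((y - x : ℝ)) : ℂ)) := by
    rw [hRm_eq, mainTerm, mainTerm, show (1 : ℂ) + a = a + 1 by ring]
    field_simp
    push_cast
    ring
  rw [hid, norm_div, norm_mul, Complex.norm_real, Real.norm_of_nonneg hyx.le]
  have ha_pos : 0 < ‖a‖ := norm_pos_iff.2 ha0
  rw [div_le_iff₀ (by positivity)]
  calc ‖Rm‖ ≤ ‖a‖ * (y - x) ^ 2 / 2 := hRm_le
    _ = (y - x) / 2 * (‖a‖ * (y - x)) := by ring

namespace TwistData

variable {b : ℕ → ℂ} {G : ℂ → ℂ} {δ a : ℂ} {σ₁ T B : ℝ}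

/-- **The differencing step**: under `TwistData`, for `1 ≤ x < y`,
`‖U(x) − δ x^a/a‖ ≤ (‖R(y) − δM(y)‖ + ‖R(x) − δM(x)‖)/(y − x) + (y − x)/2 + 1 + (ψ(y) − ψ(x))`,
`U(x) = ∑_{n ≤ x} b(n)`: from `R(y) − R(x) = (y − x)U(x) + ∑_{x < n ≤ y} b(n)(y − n)`, the
main-term differencing `norm_mainTerm_div_sub_le`, `|δ/a| ≤ 1` and `norm_boundary_sum_le`.
[cite: LandauMathAnn1903, §8] -/
theorem norm_sum_sub_le (h : TwistData b G δ a σ₁ T B) {x y : ℝ} (hx : 1 ≤ x) (hxy : x < y) :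
    ‖∑ n ∈ Finset.Ioc 0 ⌊x⌋₊, b n - δ * (x : ℂ) ^ a / a‖ ≤
      (‖rieszMeanC b y - δ * mainTerm a y‖ + ‖rieszMeanC b x - δ * mainTerm a x‖) / (y - x) +
        (y - x) / 2 + 1 + (Chebyshev.psi y - Chebyshev.psi x) := by
  have hx0 : 0 < x := by linarith
  have hyx : 0 < y - x := by linarith
  have hyx0 : (((y - x : ℝ)) : ℂ) ≠ 0 := ofReal_ne_zero.2 hyx.ne'
  have ha0 : a ≠ 0 := fun h' ↦ by have := h.a_re; rw [h'] at this; simp at this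
  have ha1 : 1 ≤ ‖a‖ := by rw [← h.a_re]; exact Complex.re_le_norm a
  set U : ℂ := ∑ n ∈ Finset.Ioc 0 ⌊x⌋₊, b n with hU
  set E : ℂ := ∑ n ∈ Finset.Ioc ⌊x⌋₊ ⌊y⌋₊, b n * ((y : ℂ) - n) with hE
  set Iy : ℂ := rieszMeanC b y - δ * mainTerm a y with hIy
  set Ix : ℂ := rieszMeanC b x - δ * mainTerm a x with hIx
  set D : ℂ := (mainTerm a y - mainTerm a x) / (((y - x : ℝ)) : ℂ) - ((x : ℂ) ^ a - 1) / a with hD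
  have hR := rieszMeanC_sub_eq b hxy.le
  rw [← hU, ← hE] at hR
  -- the algebraic identity
  have h1 : (((y - x : ℝ)) : ℂ) * U = Iy - Ix + δ * (mainTerm a y - mainTerm a x) - E := by
    rw [hIy, hIx]; linear_combination -hR
  have hU' : U = (Iy - Ix + δ * (mainTerm a y - mainTerm a x) - E) / (((y - x : ℝ)) : ℂ) := by
    rw [← h1, mul_div_cancel_left₀ _ hyx0]
  have hMD : (mainTerm a y - mainTerm a x) / (((y - x : ℝ)) : ℂ) = D + ((x : ℂ) ^ a - 1) / a := by
    rw [hD]; ring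
  have hid : U - δ * (x : ℂ) ^ a / a =
      (Iy - Ix) / (((y - x : ℝ)) : ℂ) + δ * D - δ / a - E / (((y - x : ℝ)) : ℂ) := by
    calc U - δ * (x : ℂ) ^ a / a
        = (Iy - Ix + δ * (mainTerm a y - mainTerm a x) - E) / (((y - x : ℝ)) : ℂ) -
            δ * (x : ℂ) ^ a / a := by rw [← hU']
      _ = (Iy - Ix) / (((y - x : ℝ)) : ℂ) +
            δ * ((mainTerm a y - mainTerm a x) / (((y - x : ℝ)) : ℂ)) -
            E / (((y - x : ℝ)) : ℂ) - δ * (x : ℂ) ^ a / a := by ring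
      _ = (Iy - Ix) / (((y - x : ℝ)) : ℂ) + δ * D - δ / a - E / (((y - x : ℝ)) : ℂ) := by
            rw [hMD]; ring
  rw [hid]
  have hn1 : ‖(Iy - Ix) / (((y - x : ℝ)) : ℂ)‖ ≤ (‖Iy‖ + ‖Ix‖) / (y - x) := by
    rw [norm_div, Complex.norm_real, Real.norm_of_nonneg hyx.le]
    exact div_le_div_of_nonneg_right (norm_sub_le _ _) hyx.le
  have hn2 : ‖δ * D‖ ≤ (y - x) / 2 := by
    rw [norm_mul]
    calc ‖δ‖ * ‖D‖ ≤ 1 * ((y - x) / 2) :=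
          mul_le_mul h.norm_delta_le (norm_mainTerm_div_sub_le h.a_re hx0 hxy) (norm_nonneg _)
            zero_le_one
      _ = (y - x) / 2 := one_mul _
  have hn3 : ‖δ / a‖ ≤ 1 := by
    rw [norm_div]
    calc ‖δ‖ / ‖a‖ ≤ 1 / 1 := div_le_div₀ zero_le_one h.norm_delta_le one_pos ha1
      _ = 1 := by norm_num
  have hn4 : ‖E / (((y - x : ℝ)) : ℂ)‖ ≤ Chebyshev.psi y - Chebyshev.psi x := by
    rw [norm_div, Complex.norm_real, Real.norm_of_nonneg hyx.le, div_le_iff₀ hyx, mul_comm]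
    exact norm_boundary_sum_le h.norm_le hxy.le
  calc ‖(Iy - Ix) / (((y - x : ℝ)) : ℂ) + δ * D - δ / a - E / (((y - x : ℝ)) : ℂ)‖
      ≤ ‖(Iy - Ix) / (((y - x : ℝ)) : ℂ)‖ + ‖δ * D‖ + ‖δ / a‖ + ‖E / (((y - x : ℝ)) : ℂ)‖ := by
        calc _ ≤ ‖(Iy - Ix) / (((y - x : ℝ)) : ℂ) + δ * D - δ / a‖ + ‖E / (((y - x : ℝ)) : ℂ)‖ :=
              norm_sub_le _ _
          _ ≤ ‖(Iy - Ix) / (((y - x : ℝ)) : ℂ) + δ * D‖ + ‖δ / a‖ + ‖E / (((y - x : ℝ)) : ℂ)‖ := by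
              gcongr; exact norm_sub_le _ _
          _ ≤ _ := by gcongr; exact norm_add_le _ _
    _ ≤ (‖Iy‖ + ‖Ix‖) / (y - x) + (y - x) / 2 + 1 + (Chebyshev.psi y - Chebyshev.psi x) := by
        linarith

end TwistData

end TwistedRieszMean

end Literature.NumberTheory.LFunctions
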